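import Summits.BirchSwinnertonDyer.BirchSwinnertonDyer.Theorems.ManinLocalTwoThreeManinPrimeToThreeAtNineGloballyTwistMinimal
import Summits.BirchSwinnertonDyer.BirchSwinnertonDyer.Theorems.ManinLocalTwoThreeManinPrimeToThreeAtNineKatoShiftLever

/-!
# Route `ManinLocalTwoThree`, crux C3 `ManinPrimeToThreeAtNine` (stmt-BirchSwinnertonDyer-22968): RESIDUAL SYNTHESIS
# across the registered lines — the shift-twist certificate need only hold, and the reducible residual need only
# be supplied, on the GLOBALLY TWIST-MINIMAL classes (line prover p1, lead integration step; helper)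

The two families of landed reductions compose:
* UNTWISTING (seat p2: `maninLocalTwoThree_maninPrimeToThreeAtNine_of_globallyTwistMinimal`): C3 follows from
  its own statement on the optimal curves with `9 ∣ N` whose class admits NO single-prime semistable untwist
  (ternary `χ₋₃`; odd `χ_{q*}`, `q ≠ 3`, `q² ∣ N`; dyadic `χ₋₄, χ_{±8}` when `4 ∣ N`).
* EULER-SYSTEM SPLIT (planner es, typer ty, seat p1: `maninPrimeToThreeAtNine_of_katoShift_of_reducible`,
  `katoShiftTwistManinThree_of_katoFact_of_generation`): on the `W[3]`-irreducible locus the shift-twist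
  certificate E-es-18 decides, leaving the typed residual `ManinPrimeToThreeOfReducible` (`W[3]` reducible).
Hence (this file): **C3 ⟸ (certificate on the globally twist-minimal irreducible classes) ∧ (Manin at `3` on
the globally twist-minimal reducible classes)** — `maninPrimeToThreeAtNine_of_minimalKatoShift_of_minimalReducible`
(hypotheses inlined, no new definition), with the by-name corollaries
`maninPrimeToThreeAtNine_of_katoShift_of_minimalReducible` (`KatoShiftTwistManinThree` ∧ minimal reducible
residual) and `maninPrimeToThreeAtNine_of_katoFact_of_generation_of_minimalReducible` (the `p = 3` Kato fact ∧
`ShiftClassGenerationThree` ∧ minimal reducible residual). The residual leaf `ManinPrimeToThreeOfReducible` is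
thereby needed only on its globally twist-minimal part (census HOME/p1/H2H3-census-globally-twist-minimal-p1.md,
Cremona `N < 5·10⁵`: of the 657 019 optimal curves with `9 ∣ N`, the `W[3]`-reducible globally twist-minimal
ones number 23 192; `N ≤ 5000`: 581 of the 840 reducible ones are `χ₋₃`-twist-minimal).
HONEST FRAMING: `proof.conditional` reductions; every certificate / residual input is open (F-es-18 is a
statement-only fact, E-es-19 a conjecture). Manin's conjecture at `3` is NOT proved here; nothing about BSD is
proved here.
-/

set_option autoImplicit false
set_option linter.dupNamespace false

noncomputable section

open scoped Classical MatrixGroups ModularForm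

open CongruenceSubgroup WeierstrassCurve Literature.NumberTheory.EllipticCurves
  Literature.NumberTheory.EllipticCurves.ModularForms
  Summit.BirchSwinnertonDyer.Rank1Residual.ManinAdditive

namespace Summit.BirchSwinnertonDyer.BirchSwinnertonDyer.Theorems.ManinLocalTwoThree

section Three

/-- **C3 ⟸ (shift-twist certificate on the globally twist-minimal `W[3]`-irreducible classes) ∧ (Manin at `3`
on the globally twist-minimal `W[3]`-reducible classes)** — both hypotheses quantify only over lattice-optimal
data of globally minimal curves with `9 ∣ N` whose class has no `χ₋₃`, no odd `χ_{q*}` (`q ≠ 3`, `q² ∣ N`) and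
no dyadic (`4 ∣ N`) semistable untwist; concluding the route decl
`Summit.BirchSwinnertonDyer.BirchSwinnertonDyer.Theses.ManinLocalTwoThree.ManinPrimeToThreeAtNine` BY NAME via
`maninLocalTwoThree_maninPrimeToThreeAtNine_of_globallyTwistMinimal` and excluded middle on irreducibility.
[cite: Stevens1989, Lemmas (5.2), (5.4)] [cite: Kato2004Asterisque, Thm. 9.7 (p. 189)] -/
theorem maninPrimeToThreeAtNine_of_minimalKatoShift_of_minimalReducible
    (hA : ∀ (W : WeierstrassCurve ℚ) [W.IsElliptic] [W.IsGloballyMinimal] {N : ℕ} [NeZero N]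
      (D : ModularParametrizationData W N),
      (∀ z ∈ D.L.lattice, ∃ w ∈ periodLattice D.f, z = D.c * w) → 3 ^ 2 ∣ N →
      ¬ (∃ (W' : WeierstrassCurve ℚ) (d : ℤ), W'.IsElliptic ∧ W'.IsGloballyMinimal ∧
        (d = -3) ∧ IsIsogenous W (W'.quadraticTwist (d : ℚ)) ∧ ¬ 3 ^ 2 ∣ W'.conductorNorm ℤ) →
      ¬ (∃ (W' : WeierstrassCurve ℚ) (q : ℕ), W'.IsElliptic ∧ W'.IsGloballyMinimal ∧
        q.Prime ∧ q ≠ 2 ∧ q ≠ 3 ∧ q ^ 2 ∣ N ∧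
        IsIsogenous W (W'.quadraticTwist (((-1 : ℤ) ^ (q / 2) * q : ℤ) : ℚ)) ∧
        ¬ q ^ 2 ∣ W'.conductorNorm ℤ) →
      ¬ (∃ (W' : WeierstrassCurve ℚ) (d : ℤ), W'.IsElliptic ∧ W'.IsGloballyMinimal ∧
        (d = -1 ∨ d = 2 ∨ d = -2) ∧ 2 ^ 2 ∣ N ∧ IsIsogenous W (W'.quadraticTwist (d : ℚ)) ∧
        ¬ 2 ^ 2 ∣ W'.conductorNorm ℤ) →
      W.HasIrreducibleModPGaloisRep 3 → ¬ (3 : ℤ) ∣ D.c)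
    (hB : ∀ (W : WeierstrassCurve ℚ) [W.IsElliptic] [W.IsGloballyMinimal] {N : ℕ} [NeZero N]
      (D : ModularParametrizationData W N),
      (∀ z ∈ D.L.lattice, ∃ w ∈ periodLattice D.f, z = D.c * w) → 3 ^ 2 ∣ N →
      ¬ (∃ (W' : WeierstrassCurve ℚ) (d : ℤ), W'.IsElliptic ∧ W'.IsGloballyMinimal ∧
        (d = -3) ∧ IsIsogenous W (W'.quadraticTwist (d : ℚ)) ∧ ¬ 3 ^ 2 ∣ W'.conductorNorm ℤ) →
      ¬ (∃ (W' : WeierstrassCurve ℚ) (q : ℕ), W'.IsElliptic ∧ W'.IsGloballyMinimal ∧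
        q.Prime ∧ q ≠ 2 ∧ q ≠ 3 ∧ q ^ 2 ∣ N ∧
        IsIsogenous W (W'.quadraticTwist (((-1 : ℤ) ^ (q / 2) * q : ℤ) : ℚ)) ∧
        ¬ q ^ 2 ∣ W'.conductorNorm ℤ) →
      ¬ (∃ (W' : WeierstrassCurve ℚ) (d : ℤ), W'.IsElliptic ∧ W'.IsGloballyMinimal ∧
        (d = -1 ∨ d = 2 ∨ d = -2) ∧ 2 ^ 2 ∣ N ∧ IsIsogenous W (W'.quadraticTwist (d : ℚ)) ∧
        ¬ 2 ^ 2 ∣ W'.conductorNorm ℤ) →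
      ¬ W.HasIrreducibleModPGaloisRep 3 → ¬ (3 : ℤ) ∣ D.c) :
    Summit.BirchSwinnertonDyer.BirchSwinnertonDyer.Theses.ManinLocalTwoThree.ManinPrimeToThreeAtNine :=
  maninLocalTwoThree_maninPrimeToThreeAtNine_of_globallyTwistMinimal
    (fun _hM _hAU _hC _hnf W _ _ N _ D hopt h9 hmin hodd hdy => by
      show ¬ (3 : ℤ) ∣ D.c
      by_cases hirr : W.HasIrreducibleModPGaloisRep 3
      · exact hA W D hopt h9 hmin hodd hdy hirr
      · exact hB W D hopt h9 hmin hodd hdy hirr)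

/-- **C3 ⟸ E-es-18 `KatoShiftTwistManinThree` ∧ (Manin at `3` on the globally twist-minimal `W[3]`-reducible
classes)**: the reducible residual leaf `ManinPrimeToThreeOfReducible` is needed only on its globally
twist-minimal part. [cite: Stevens1989, Lemmas (5.2), (5.4)] [cite: Kato2004Asterisque, Thm. 9.7 (p. 189)] -/
theorem maninPrimeToThreeAtNine_of_katoShift_of_minimalReducible (hA : KatoShiftTwistManinThree)
    (hB : ∀ (W : WeierstrassCurve ℚ) [W.IsElliptic] [W.IsGloballyMinimal] {N : ℕ} [NeZero N]
      (D : ModularParametrizationData W N),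
      (∀ z ∈ D.L.lattice, ∃ w ∈ periodLattice D.f, z = D.c * w) → 3 ^ 2 ∣ N →
      ¬ (∃ (W' : WeierstrassCurve ℚ) (d : ℤ), W'.IsElliptic ∧ W'.IsGloballyMinimal ∧
        (d = -3) ∧ IsIsogenous W (W'.quadraticTwist (d : ℚ)) ∧ ¬ 3 ^ 2 ∣ W'.conductorNorm ℤ) →
      ¬ (∃ (W' : WeierstrassCurve ℚ) (q : ℕ), W'.IsElliptic ∧ W'.IsGloballyMinimal ∧
        q.Prime ∧ q ≠ 2 ∧ q ≠ 3 ∧ q ^ 2 ∣ N ∧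
        IsIsogenous W (W'.quadraticTwist (((-1 : ℤ) ^ (q / 2) * q : ℤ) : ℚ)) ∧
        ¬ q ^ 2 ∣ W'.conductorNorm ℤ) →
      ¬ (∃ (W' : WeierstrassCurve ℚ) (d : ℤ), W'.IsElliptic ∧ W'.IsGloballyMinimal ∧
        (d = -1 ∨ d = 2 ∨ d = -2) ∧ 2 ^ 2 ∣ N ∧ IsIsogenous W (W'.quadraticTwist (d : ℚ)) ∧
        ¬ 2 ^ 2 ∣ W'.conductorNorm ℤ) →
      ¬ W.HasIrreducibleModPGaloisRep 3 → ¬ (3 : ℤ) ∣ D.c) :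
    Summit.BirchSwinnertonDyer.BirchSwinnertonDyer.Theses.ManinLocalTwoThree.ManinPrimeToThreeAtNine :=
  maninPrimeToThreeAtNine_of_minimalKatoShift_of_minimalReducible
    (fun W _ _ _ _ D hopt h9 _ _ _ hirr => hA W D hopt h9 hirr) hB

/-- **C3 ⟸ the `p = 3` Kato fact F-es-18 ∧ the shift-generation law E-es-19 ∧ (Manin at `3` on the globally
twist-minimal `W[3]`-reducible classes)** — the line `kato-shift-three` end to end with the smallest residual the
landed reductions allow. A `proof.conditional`: the fact is statement-only, the law is a conjecture, the residual
is open. [cite: Kato2004Asterisque, Thm. 9.7 (p. 189)] [cite: Stevens1989, Lemmas (5.2), (5.4)] -/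
theorem maninPrimeToThreeAtNine_of_katoFact_of_generation_of_minimalReducible
    (hK : kato_neron_isIntegral_twistedSymbolSum_of_additive_three_polar) (hG : ShiftClassGenerationThree)
    (hB : ∀ (W : WeierstrassCurve ℚ) [W.IsElliptic] [W.IsGloballyMinimal] {N : ℕ} [NeZero N]
      (D : ModularParametrizationData W N),
      (∀ z ∈ D.L.lattice, ∃ w ∈ periodLattice D.f, z = D.c * w) → 3 ^ 2 ∣ N →
      ¬ (∃ (W' : WeierstrassCurve ℚ) (d : ℤ), W'.IsElliptic ∧ W'.IsGloballyMinimal ∧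
        (d = -3) ∧ IsIsogenous W (W'.quadraticTwist (d : ℚ)) ∧ ¬ 3 ^ 2 ∣ W'.conductorNorm ℤ) →
      ¬ (∃ (W' : WeierstrassCurve ℚ) (q : ℕ), W'.IsElliptic ∧ W'.IsGloballyMinimal ∧
        q.Prime ∧ q ≠ 2 ∧ q ≠ 3 ∧ q ^ 2 ∣ N ∧
        IsIsogenous W (W'.quadraticTwist (((-1 : ℤ) ^ (q / 2) * q : ℤ) : ℚ)) ∧
        ¬ q ^ 2 ∣ W'.conductorNorm ℤ) →
      ¬ (∃ (W' : WeierstrassCurve ℚ) (d : ℤ), W'.IsElliptic ∧ W'.IsGloballyMinimal ∧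
        (d = -1 ∨ d = 2 ∨ d = -2) ∧ 2 ^ 2 ∣ N ∧ IsIsogenous W (W'.quadraticTwist (d : ℚ)) ∧
        ¬ 2 ^ 2 ∣ W'.conductorNorm ℤ) →
      ¬ W.HasIrreducibleModPGaloisRep 3 → ¬ (3 : ℤ) ∣ D.c) :
    Summit.BirchSwinnertonDyer.BirchSwinnertonDyer.Theses.ManinLocalTwoThree.ManinPrimeToThreeAtNine :=
  maninPrimeToThreeAtNine_of_katoShift_of_minimalReducible
    (katoShiftTwistManinThree_of_katoFact_of_generation hK hG) hB

end Three

end Summit.BirchSwinnertonDyer.BirchSwinnertonDyer.Theorems.ManinLocalTwoThree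

end
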